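import Mathlib
import HarnessLib
import Literature.Geometry.DiscreteGeometry.BondGraph
import Literature.MathematicalPhysics.StatisticalMechanics.BarlowStacking
import Summits.AtomisticToContinuum.Crystallization.Theses.PricedLinkCensus

/-!
# `SoftLayerPropagation`: basic glue (positive scale at charge-free sites; scaling of Barlow stackings)

Route `PricedLinkCensus`, crux `SoftLayerPropagation` (stmt-AtomisticToContinuum-14233), line
`Sketch` (skeleton `Cruxes/SoftLayerPropagation/Lines/Sketch.lean`).  Helper file serving the crux
(`--supports`): the three pieces of glue the composition `SoftLayerPropagation_of` uses around the
six registered stubs.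

* `nearestDist_pos_of_isChargeFree` — a charge-free site has `nn_i > 0` (for ANY real `η`): if
  `nn_i = 0` the bonds of `i` are exactly the sites coinciding with `y i`, and then the ring number
  of any bond `{i, k}` is `11`, not `4`.  This disposes of the degenerate scale in every statement
  of the route that starts from `IsChargeFree`.
* `barlowPos_eq_smul`, `smul_mem_barlowStacking`, `exists_eq_smul_of_mem_barlowStacking` — the
  Barlow stacking of spacing `a` and layer spacing `a c` is `a •` the unit one
  (`barlowStacking a (a c) s = a • barlowStacking 1 c s` pointwise), so the crux's reference
  `barlowStacking nn_i (nn_i √(2/3)) s` is the unit shadow stacking rescaled.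

No new definitions.
-/

noncomputable section

namespace Summit.AtomisticToContinuum.Crystallization.Theorems

open Literature.Geometry.DiscreteGeometry Literature.MathematicalPhysics.StatisticalMechanics
open scoped Pointwise

/-- **A charge-free site has positive scale.**  If `nn_i = 0` then the bonds of `i` are exactly the
sites `k ≠ i` with `dist (y i) (y k) = 0` (a bond needs `dist ≤ (1+η)·min 0 nn_k = 0`); if there
are twelve of them, any one of them, `k`, has scale `0` too and its bonds are the sites coinciding
with it, so the common neighbours of `i` and `k` are the other eleven: ring number `11 ≠ 4`.
No sign condition on `η` is needed, and the index type is any type. -/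
theorem nearestDist_pos_of_isChargeFree {ι X : Type*} [PseudoMetricSpace X] {η : ℝ} {y : ι → X}
    {i : ι} (h : IsChargeFree η y i) : 0 < nearestDist y i := by
  rcases (nearestDist_nonneg y i).eq_or_lt with h0 | hpos
  · exfalso
    -- with scale `0`, the neighbours of a site are the sites at distance `0` from it
    have key : ∀ {j : ι}, nearestDist y j = 0 →
        ∀ k, k ∈ (bondGraph η y).neighborSet j ↔ k ≠ j ∧ dist (y j) (y k) = 0 := by
      intro j hj k
      rw [mem_neighborSet_bondGraph, hj]
      have hmin : min (0 : ℝ) (nearestDist y k) = 0 := min_eq_left (nearestDist_nonneg y k)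
      rw [hmin, mul_zero]
      constructor
      · rintro ⟨hne, hle⟩
        exact ⟨fun h => hne h.symm, le_antisymm hle dist_nonneg⟩
      · rintro ⟨hne, hd⟩
        exact ⟨fun h => hne h.symm, hd.le⟩
    have hN := key h0.symm
    have hcard := h.1
    obtain ⟨k, hk⟩ : ((bondGraph η y).neighborSet i).Nonempty :=
      Set.nonempty_of_ncard_ne_zero (by rw [hcard]; decide)
    obtain ⟨hki, hdk⟩ := (hN k).1 hk
    -- `nn_k = 0` as well
    have hk0 : nearestDist y k = 0 := by
      refine le_antisymm ?_ (nearestDist_nonneg y k)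
      have := nearestDist_le_dist y (j := k) (k := i) (fun h => hki h.symm)
      rwa [dist_comm, hdk] at this
    have hNk := key hk0
    -- the common neighbours of `i` and `k` are `N(i) \ {k}`
    have hinter : (bondGraph η y).neighborSet i ∩ (bondGraph η y).neighborSet k =
        (bondGraph η y).neighborSet i \ {k} := by
      ext m
      simp only [Set.mem_inter_iff, Set.mem_sdiff, Set.mem_singleton_iff, hN, hNk]
      constructor
      · rintro ⟨⟨hmi, hdm⟩, hmk, -⟩
        exact ⟨⟨hmi, hdm⟩, hmk⟩
      · rintro ⟨⟨hmi, hdm⟩, hmk⟩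
        refine ⟨⟨hmi, hdm⟩, hmk, ?_⟩
        have h1 : dist (y k) (y m) ≤ dist (y k) (y i) + dist (y i) (y m) := dist_triangle _ _ _
        rw [dist_comm (y k) (y i), hdk, hdm, zero_add] at h1
        exact le_antisymm h1 dist_nonneg
    have hring := h.2 k hk
    rw [ringNumber_def, hinter, Set.ncard_sdiff_singleton_of_mem hk, hcard] at hring
    omega
  · exact hpos

/-- In the crux's setting: if every site within `8·nn_i` of `y i` is charge-free then in particular
`i` is, so `nn_i > 0`. -/
theorem nearestDist_pos_of_ball_chargeFree {N : ℕ} {η : ℝ} {y : Fin N → EuclideanSpace ℝ (Fin 3)}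
    {i : Fin N}
    (hcf : ∀ j : Fin N, dist (y i) (y j) ≤ 8 * nearestDist y i → IsChargeFree η y j) :
    0 < nearestDist y i :=
  nearestDist_pos_of_isChargeFree (hcf i (by
    rw [dist_self]; exact mul_nonneg (by norm_num) (nearestDist_nonneg y i)))

/-! ### Scaling of Barlow stackings -/

/-- `u(a) = a • u(1)`. -/
theorem triangularVec₁_eq_smul (a : ℝ) : triangularVec₁ a = a • triangularVec₁ 1 := by
  ext l; fin_cases l <;> simp [triangularVec₁]

/-- `v(a) = a • v(1)`. -/
theorem triangularVec₂_eq_smul (a : ℝ) : triangularVec₂ a = a • triangularVec₂ 1 := by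
  ext l; fin_cases l <;> simp [triangularVec₂] <;> ring

/-- `w(a) = a • w(1)`. -/
theorem barlowOffset_eq_smul (a : ℝ) : barlowOffset a = a • barlowOffset 1 := by
  ext l; fin_cases l <;> simp [barlowOffset] <;> ring

/-- `(a c) e₃ = a • (c e₃)`. -/
theorem layerNormal_eq_smul (a c : ℝ) : layerNormal (a * c) = a • layerNormal c := by
  ext l; fin_cases l <;> simp [layerNormal]

/-- **Barlow stackings scale**: `barlowPos a (a c) s k i j = a • barlowPos 1 c s k i j`. -/
theorem barlowPos_eq_smul (a c : ℝ) (s : ℤ → ℤ) (k i j : ℤ) :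
    barlowPos a (a * c) s k i j = a • barlowPos 1 c s k i j := by
  simp only [barlowPos, triangularVec₁_eq_smul a, triangularVec₂_eq_smul a, barlowOffset_eq_smul a,
    layerNormal_eq_smul a c, smul_add, smul_comm _ a]

/-- Scaling a point of the unit stacking by `a` gives a point of the stacking of spacing `a`
(layer spacing `a c`). -/
theorem smul_mem_barlowStacking {a c : ℝ} {s : ℤ → ℤ} {x : EuclideanSpace ℝ (Fin 3)}
    (hx : x ∈ barlowStacking 1 c s) : a • x ∈ barlowStacking a (a * c) s := by
  obtain ⟨k, i, j, rfl⟩ := hx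
  exact ⟨k, i, j, (barlowPos_eq_smul a c s k i j).symm⟩

/-- Conversely, every point of the stacking of spacing `a` (layer spacing `a c`) is `a •` a point of
the unit stacking. -/
theorem exists_eq_smul_of_mem_barlowStacking {a c : ℝ} {s : ℤ → ℤ} {z : EuclideanSpace ℝ (Fin 3)}
    (hz : z ∈ barlowStacking a (a * c) s) : ∃ x ∈ barlowStacking 1 c s, z = a • x := by
  obtain ⟨k, i, j, rfl⟩ := hz
  exact ⟨barlowPos 1 c s k i j, ⟨k, i, j, rfl⟩, barlowPos_eq_smul a c s k i j⟩

/-- The two directions together: `barlowStacking a (a c) s = a • barlowStacking 1 c s`. -/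
theorem barlowStacking_eq_smul (a c : ℝ) (s : ℤ → ℤ) :
    barlowStacking a (a * c) s = a • barlowStacking 1 c s := by
  ext z
  constructor
  · intro hz
    obtain ⟨x, hx, rfl⟩ := exists_eq_smul_of_mem_barlowStacking hz
    exact Set.smul_mem_smul_set hx
  · rintro ⟨x, hx, rfl⟩
    exact smul_mem_barlowStacking hx

/-- **Registered form** (sub-goal `basics_nearestDistPos` of crux stmt-AtomisticToContinuum-14233):
in the route's types, a charge-free site has positive scale. -/
theorem basics_nearestDistPos : ∀ (N : ℕ) (η : ℝ) (y : Fin N → EuclideanSpace ℝ (Fin 3)) (i : Fin N),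
    Literature.Geometry.DiscreteGeometry.IsChargeFree η y i →
      0 < Literature.Geometry.DiscreteGeometry.nearestDist y i :=
  fun _ _ _ _ h => nearestDist_pos_of_isChargeFree h

/-- **Registered form** (sub-goal `basics_barlowScaling` of crux stmt-AtomisticToContinuum-14233):
the Barlow stacking of spacing `a`, layer spacing `a c`, is `a •` the unit one, pointwise. -/
theorem basics_barlowScaling : ∀ (a c : ℝ) (s : ℤ → ℤ) (k i j : ℤ),
    Literature.MathematicalPhysics.StatisticalMechanics.barlowPos a (a * c) s k i j =
      a • Literature.MathematicalPhysics.StatisticalMechanics.barlowPos 1 c s k i j :=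
  barlowPos_eq_smul

end Summit.AtomisticToContinuum.Crystallization.Theorems

end
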